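import Summits.AtomisticToContinuum.Crystallization.Theorems.FreeSplittingCertificatesRadiusLadderKeyGluing

/-!
# Free-splitting certificates — minimal refuting zoos are key-connected (the structure of a refutation)

Support for crux `FreeSplittingCertificates.FiniteRangeSplitting` (item `stmt-AtomisticToContinuum-12559`),
continuing `…RadiusLadderKeyGluing`.  VALUE = a theorem about the finite LP falsifier of the radius ladder
`RungAt δ R`, NOT summit progress: nothing here decides a route item.

`refuting_or_of_refuting_union` (refutations localise to key-disjoint parts) is iterated down to a structure
theorem for refuting zoos:

* `KeyConnected R Z` — the zoo cannot be cut into two nonempty disjoint parts with disjoint realised key sets.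
* `exists_keyConnected_refuting` — **every refuting zoo contains a nonempty key-connected refuting sub-zoo**
  (strong induction on the cardinality: cut along a key-disjoint partition, keep the refuting side).
* `exists_cross_recurrence_of_keyConnected` — in a key-connected zoo with at least two configurations, every
  configuration has a bond whose realised key recurs at a bond of ANOTHER configuration of the zoo.
* `exists_lt_dist_of_refuting_singleton` — a one-configuration refuting zoo has diameter `> R`
  (`exists_feasibleOn_singleton_of_diam_le`, contrapositive) and, by `exists_recurrence_of_refuting`, an
  internal recurrence.
* `refutation_structure_of_not_rungAt` — **the structure of a non-rung**: `¬ RungAt δ R` (`0 < δ`) is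
  witnessed by a nonempty key-connected refuting zoo of `δ`-separated configurations which is EITHER a single
  configuration of diameter `> R` with two distinct bonds realising the same key, OR has at least two
  configurations each of which shares a realised key with another one — RESULTS-R2 §6 P4 ("only matched
  recurrences across rows can refute") as a theorem over the crux vocabulary.

All statements are over `eInf` (unconditional).
-/

noncomputable section
namespace Summit.AtomisticToContinuum.Crystallization.Theorems.StrictSplittingRuleBirth

open scoped BigOperators Classical
open Literature.MathematicalPhysics.StatisticalMechanics

/-- Euclidean `3`-space. -/
local notation "E3" => EuclideanSpace ℝ (Fin 3)

/-! ## Key-connected zoos -/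

/-- A zoo is KEY-CONNECTED at radius `R` when it cannot be cut into two nonempty disjoint parts whose realised
key sets are disjoint (every nontrivial cut severs a shared key). [folklore] -/
def KeyConnected (R : ℝ) (Z : Finset Conf) : Prop :=
  ∀ Z₁ Z₂ : Finset Conf, Z₁ ∪ Z₂ = Z → Disjoint Z₁ Z₂ → Z₁.Nonempty → Z₂.Nonempty →
    ¬ Disjoint (zkeys R Z₁) (zkeys R Z₂)

/-- A singleton zoo is key-connected (it has no nontrivial cut). -/
theorem keyConnected_singleton (R : ℝ) (c : Conf) : KeyConnected R {c} := by
  intro Z₁ Z₂ hU hD h₁ h₂ _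
  obtain ⟨c₁, hc₁⟩ := h₁
  obtain ⟨c₂, hc₂⟩ := h₂
  have e₁ : c₁ = c := Finset.mem_singleton.1 (hU ▸ Finset.mem_union_left Z₂ hc₁)
  have e₂ : c₂ = c := Finset.mem_singleton.1 (hU ▸ Finset.mem_union_right Z₁ hc₂)
  subst e₁
  subst e₂
  exact Finset.disjoint_left.1 hD hc₁ hc₂

/-- A refuting zoo is nonempty (the half rule must fail somewhere). -/
theorem nonempty_of_refuting (R : ℝ) {Z : Finset Conf}
    (href : ∀ Φ : E3 → Finset E3 → ℝ, IsRule Φ → ∃ c ∈ Z, ∃ i : Fin c.1, siteE R Φ c.2 i < eInf) :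
    Z.Nonempty := by
  obtain ⟨c, hc, -⟩ := href halfRule isRule_halfRule
  exact ⟨c, hc⟩

/-- **Every refuting zoo contains a nonempty key-connected refuting sub-zoo.** -/
theorem exists_keyConnected_refuting (R : ℝ) (Z : Finset Conf)
    (href : ∀ Φ : E3 → Finset E3 → ℝ, IsRule Φ → ∃ c ∈ Z, ∃ i : Fin c.1, siteE R Φ c.2 i < eInf) :
    ∃ Z' : Finset Conf, Z' ⊆ Z ∧ Z'.Nonempty ∧ KeyConnected R Z' ∧
      ∀ Φ : E3 → Finset E3 → ℝ, IsRule Φ → ∃ c ∈ Z', ∃ i : Fin c.1, siteE R Φ c.2 i < eInf := by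
  classical
  induction Z using Finset.strongInductionOn with
  | _ Z ih =>
    by_cases hconn : KeyConnected R Z
    · exact ⟨Z, Finset.Subset.refl Z, nonempty_of_refuting R href, hconn, href⟩
    · simp only [KeyConnected] at hconn
      push Not at hconn
      obtain ⟨Z₁, Z₂, hU, hD, h₁, h₂, hK⟩ := hconn
      have hsub₁ : Z₁ ⊂ Z := by
        rw [← hU]
        refine ⟨Finset.subset_union_left, fun h => ?_⟩
        obtain ⟨c, hc⟩ := h₂
        exact Finset.disjoint_left.1 hD (h (Finset.mem_union_right Z₁ hc)) hc
      have hsub₂ : Z₂ ⊂ Z := by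
        rw [← hU]
        refine ⟨Finset.subset_union_right, fun h => ?_⟩
        obtain ⟨c, hc⟩ := h₁
        exact Finset.disjoint_left.1 hD hc (h (Finset.mem_union_left Z₂ hc))
      rw [← hU] at href
      rcases refuting_or_of_refuting_union R hK href with hr | hr
      · obtain ⟨Z', hZ', hne, hc, hr'⟩ := ih Z₁ hsub₁ hr
        exact ⟨Z', hZ'.trans hsub₁.1, hne, hc, hr'⟩
      · obtain ⟨Z', hZ', hne, hc, hr'⟩ := ih Z₂ hsub₂ hr
        exact ⟨Z', hZ'.trans hsub₂.1, hne, hc, hr'⟩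

/-- **Cross recurrences in a key-connected zoo**: if `Z` is key-connected and has a configuration other than
`c ∈ Z`, then some bond of `c` realises the same key as some bond of another configuration of `Z`. -/
theorem exists_cross_recurrence_of_keyConnected (R : ℝ) {Z : Finset Conf} (hZ : KeyConnected R Z)
    {c : Conf} (hc : c ∈ Z) (h2 : ∃ c' ∈ Z, c' ≠ c) :
    ∃ b ∈ zbonds Z, ∃ b' ∈ zbonds Z, b.1 = c ∧ b'.1 ≠ c ∧ zkey R b = zkey R b' := by
  classical
  have hcut := hZ {c} (Z.erase c) (by
      rw [Finset.union_comm, Finset.erase_union_of_mem (Finset.mem_singleton_self c) Z,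
          Finset.union_eq_left.2 (Finset.singleton_subset_iff.2 hc)])
    (Finset.disjoint_singleton_left.2 (Finset.notMem_erase c Z)) (Finset.singleton_nonempty c)
    (by obtain ⟨c', hc', hne⟩ := h2; exact ⟨c', Finset.mem_erase.2 ⟨hne, hc'⟩⟩)
  rw [Finset.not_disjoint_iff] at hcut
  obtain ⟨k, hk₁, hk₂⟩ := hcut
  obtain ⟨b, hb, hbk⟩ := mem_zkeys.1 hk₁
  obtain ⟨b', hb', hbk'⟩ := mem_zkeys.1 hk₂
  obtain ⟨hb1, hbij⟩ := mem_zbonds.1 hb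
  obtain ⟨hb'1, hb'ij⟩ := mem_zbonds.1 hb'
  rw [Finset.mem_singleton] at hb1
  obtain ⟨hne, hb'Z⟩ := Finset.mem_erase.1 hb'1
  exact ⟨b, mem_zbonds.2 ⟨hb1 ▸ hc, hbij⟩, b', mem_zbonds.2 ⟨hb'Z, hb'ij⟩, hb1, hne, hbk.trans hbk'.symm⟩

/-- **A one-configuration refuting zoo has diameter `> R`** (contrapositive of
`exists_feasibleOn_singleton_of_diam_le`). -/
theorem exists_lt_dist_of_refuting_singleton (R : ℝ) (c : Conf) (hc : Function.Injective c.2)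
    (href : ∀ Φ : E3 → Finset E3 → ℝ, IsRule Φ → ∃ c' ∈ ({c} : Finset Conf), ∃ i : Fin c'.1,
      siteE R Φ c'.2 i < eInf) :
    ∃ i j : Fin c.1, R < dist (c.2 i) (c.2 j) := by
  by_contra h
  push Not at h
  obtain ⟨Φ, hr, hf⟩ := exists_feasibleOn_singleton_of_diam_le c hc h
  obtain ⟨c', hc', i, hlt⟩ := href Φ hr
  rw [Finset.mem_singleton] at hc'
  subst hc'
  exact (not_lt.2 (hf i)) hlt

/-! ## The structure of a non-rung -/

/-- **The structure of a refutation.**  If the rung `RungAt δ R` fails (`0 < δ`), there is a finite zoo `Z` of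
`δ`-separated configurations which refutes it, is nonempty and KEY-CONNECTED, carries two distinct ordered
bonds with the same realised key, and is of one of two kinds: a SINGLE configuration, necessarily of
diameter `> R` (so the recurrence is internal: a long chain / lattice fragment seen through radius-`R`
windows), or AT LEAST TWO configurations every one of which shares a realised key with another one (matched
recurrence across rows).  Conversely nothing weaker can refute: recurrence-free zoos
(`exists_feasibleOn_of_recurrenceFree`), periodic fragments (`halfRule_feasibleOn_periodic`) and key-disjoint
unions of non-refuting zoos (`not_refuting_union_of_disjoint_zkeys`) never do. -/
theorem refutation_structure_of_not_rungAt {δ R : ℝ} (hδ : 0 < δ) (h : ¬ RungAt δ R) :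
    ∃ Z : Finset Conf, (∀ c ∈ Z, Sep δ c.2) ∧ Z.Nonempty ∧ KeyConnected R Z ∧
      (∀ Φ : E3 → Finset E3 → ℝ, IsRule Φ → ∃ c ∈ Z, ∃ i : Fin c.1, siteE R Φ c.2 i < eInf) ∧
      (∃ b ∈ zbonds Z, ∃ b' ∈ zbonds Z, b ≠ b' ∧ zkey R b = zkey R b') ∧
      ((∃ c, Z = {c} ∧ ∃ i j : Fin c.1, R < dist (c.2 i) (c.2 j)) ∨
        ∀ c ∈ Z, ∃ b ∈ zbonds Z, ∃ b' ∈ zbonds Z, b.1 = c ∧ b'.1 ≠ c ∧ zkey R b = zkey R b') := by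
  classical
  obtain ⟨Z₀, hsep₀, href₀⟩ := exists_zoo_of_not_rungAt h
  obtain ⟨Z, hZZ₀, hne, hconn, href⟩ := exists_keyConnected_refuting R Z₀ href₀
  have hsep : ∀ c ∈ Z, Sep δ c.2 := fun c hc => hsep₀ c (hZZ₀ hc)
  have hinj : ∀ c ∈ Z, Function.Injective c.2 := fun c hc => perturbative_injective_of_sep hδ (hsep c hc)
  refine ⟨Z, hsep, hne, hconn, href, exists_recurrence_of_refuting R hinj href, ?_⟩
  by_cases hcard : ∃ c, Z = {c}
  · obtain ⟨c, rfl⟩ := hcard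
    exact Or.inl ⟨c, rfl, exists_lt_dist_of_refuting_singleton R c
      (hinj c (Finset.mem_singleton_self c)) href⟩
  · refine Or.inr fun c hc => exists_cross_recurrence_of_keyConnected R hconn hc ?_
    by_contra h2
    push Not at h2
    exact hcard ⟨c, Finset.eq_singleton_iff_unique_mem.2 ⟨hc, h2⟩⟩

end Summit.AtomisticToContinuum.Crystallization.Theorems.StrictSplittingRuleBirth

end
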